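import Summits.RiemannHypothesis.RiemannHypothesis.Theorems.Splittings.RobinFiniteReflHigh
import Literature.NumberTheory.LFunctions.ZetaZeroDensityIngham1940Explicit
import Literature.NumberTheory.LFunctions.NumHelpers
import HarnessLib

/-!
# RobinFiniteCakeTail — gen 19 «LAYER CAKE AT PT», part 1/10 (A): the density tail `Σ_{T<|γ|, β ≥ σ} m/γ²` of a class `β ≥ σ` from a power row `N(σ,t) ≤ A·t^a` (`a < 2`), generic in `σ` — `densTail_le_rpow` (dyadic blocks `(4ᵏT, 4ᵏ⁺¹T]`, reflection, `Real.tsum_le_of_sum_le`). RH-free, 0 `def`.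

Cell rh-split, seat rh-split-robin-finite g19 (card `cards/SPLIT-robin-finite.md` §26); carved VERBATIM from
`HOME/rh-split-robin-finite/g19/SketchG19.lean` (sha16 c333eb23d46ea866) by `mk_carve.py`.  Nothing here bears on the truth of RH.

HONEST LABEL: SPLITTING SEARCH over kernel-typed RH-EQUIVALENCES; a splitting A ∧ B ⟹ RH is CONDITIONAL
bookkeeping unless A and B are both proved; nothing here bears on the truth of RH.
-/

set_option linter.dupNamespace false

noncomputable section

open Real Filter Finset
open scoped Chebyshev ComplexConjugate

namespace Summit.RiemannHypothesis.RiemannHypothesis.Theorems.Splittings.RobinFiniteC1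

open Literature.NumberTheory.LFunctions Literature.NumberTheory.DiophantineGeometry
open Literature.NumberTheory.LFunctions.SchoenfeldBound
open Literature.NumberTheory.LFunctions.NicolasJExplicit
open RobinAnalyticSharp
open Literature.NumberTheory.LFunctions.VdC.Num (rpow_le_of_pow_le le_rpow_of_pow_le)
open Summit.RiemannHypothesis.RiemannHypothesis.Theorems.Splittings.RobinFiniteE3
open Summit.RiemannHypothesis.RiemannHypothesis.Theorems.Splittings.RobinFiniteTail
  (zeroTailBound_tailH tailH_PT_le tailH_nonneg)
open Summit.RiemannHypothesis.RiemannHypothesis.Theorems.Splittings.RobinFiniteE1c (summable_tailTerm)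

section CakeA

/-! ### C1 · RH-free: the density tail of the class `β ≥ σ` from a power row `N(σ, t) ≤ A·t^a`, `a < 2` -/

/-- One block, any `σ`: for `0 < T₁`, the zeros with `T₁ < Im ρ ≤ T₂` and `σ ≤ Re ρ` have `Σ m(ρ)/(Im ρ)² ≤ N(σ, T₂)/T₁²`. -/
theorem sum_block_le_sigma (σ : ℝ) {T₁ T₂ : ℝ} (h1 : 0 < T₁) :
    ∑ ρ ∈ (zerosBetween T₁ T₂).filter (fun ρ => σ ≤ ρ.re), (riemannZetaZeroOrder ρ : ℝ) / ρ.im ^ 2 ≤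
      (zetaZeroCountRe σ T₂ : ℝ) / T₁ ^ 2 := by
  classical
  have hsub : (zerosBetween T₁ T₂).filter (fun ρ => σ ≤ ρ.re) ⊆ (zetaZeroBox_finite σ T₂).toFinset := by
    intro ρ hρ
    rw [Finset.mem_filter] at hρ
    obtain ⟨hz, -, h2, h3, h4⟩ := (mem_zerosBetween h1.le).1 hρ.1
    exact (Set.Finite.mem_toFinset _).2 ⟨hz, hρ.2, h2, h1.trans h3, h4⟩
  have hstep : ∀ ρ ∈ (zerosBetween T₁ T₂).filter (fun ρ => σ ≤ ρ.re),
      (riemannZetaZeroOrder ρ : ℝ) / ρ.im ^ 2 ≤ (riemannZetaZeroOrder ρ : ℝ) / T₁ ^ 2 := by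
    intro ρ hρ
    have hρ' := (Finset.mem_filter.1 hρ).1
    obtain ⟨-, -, -, h3, -⟩ := (mem_zerosBetween h1.le).1 hρ'
    exact div_le_div_of_nonneg_left (zeroOrder_nonneg_of_mem_zerosBetween h1.le hρ') (pow_pos h1 2)
      (pow_le_pow_left₀ h1.le h3.le 2)
  calc ∑ ρ ∈ (zerosBetween T₁ T₂).filter (fun ρ => σ ≤ ρ.re), (riemannZetaZeroOrder ρ : ℝ) / ρ.im ^ 2
      ≤ ∑ ρ ∈ (zerosBetween T₁ T₂).filter (fun ρ => σ ≤ ρ.re), (riemannZetaZeroOrder ρ : ℝ) / T₁ ^ 2 :=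
        Finset.sum_le_sum hstep
    _ ≤ ∑ ρ ∈ (zetaZeroBox_finite σ T₂).toFinset, (riemannZetaZeroOrder ρ : ℝ) / T₁ ^ 2 :=
        Finset.sum_le_sum_of_subset_of_nonneg hsub fun ρ hρ _ => by
          have h0 := riemannZetaZeroOrder_nonneg_of_mem_zetaZeroBox ((Set.Finite.mem_toFinset _).1 hρ)
          exact div_nonneg (by exact_mod_cast h0) (sq_nonneg _)
    _ = (zetaZeroCountRe σ T₂ : ℝ) / T₁ ^ 2 := by
        rw [← Finset.sum_div, ← natCast_zetaZeroCountRe]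

/-- Blocks `(4ᵏT, 4ᵏ⁺¹T]`, any `σ` (copy of the tree's `sum_oneSided_blocks_le`). -/
theorem sum_oneSided_blocks_le_sigma (σ : ℝ) {T U : ℝ} (hT : 0 < T) (K : ℕ) (hU : U ≤ 4 ^ K * T) :
    ∑ ρ ∈ (zerosBetween T U).filter (fun ρ => σ ≤ ρ.re), (riemannZetaZeroOrder ρ : ℝ) / ρ.im ^ 2 ≤
      ∑ k ∈ Finset.range K, (zetaZeroCountRe σ (4 ^ (k + 1) * T) : ℝ) / (4 ^ k * T) ^ 2 := by
  classical
  have hcover : (zerosBetween T U).filter (fun ρ => σ ≤ ρ.re) ⊆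
      (Finset.range K).biUnion
        (fun k => (zerosBetween (4 ^ k * T) (4 ^ (k + 1) * T)).filter (fun ρ => σ ≤ ρ.re)) := by
    intro ρ hρ
    rw [Finset.mem_filter] at hρ
    obtain ⟨hz, h1, h2, h3, h4⟩ := (mem_zerosBetween hT.le).1 hρ.1
    have hK0 : K ≠ 0 := by
      rintro rfl
      simp only [pow_zero, one_mul] at hU
      linarith
    have hex : ∃ k : ℕ, ρ.im ≤ 4 ^ (k + 1) * T :=
      ⟨K - 1, by rw [Nat.sub_add_cancel (Nat.pos_of_ne_zero hK0)]; exact h4.trans hU⟩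
    set k₀ := Nat.find hex with hk₀
    have hspec : ρ.im ≤ 4 ^ (k₀ + 1) * T := Nat.find_spec hex
    have hlow : 4 ^ k₀ * T < ρ.im := by
      rcases Nat.eq_zero_or_pos k₀ with h0 | hpos
      · rw [h0, pow_zero, one_mul]; exact h3
      · have hmin := Nat.find_min hex (m := k₀ - 1) (by omega)
        rw [not_le, Nat.sub_add_cancel hpos] at hmin
        exact hmin
    have hkK : k₀ < K := by
      have := Nat.find_le (h := hex) (n := K - 1)
        (by rw [Nat.sub_add_cancel (Nat.pos_of_ne_zero hK0)]; exact h4.trans hU)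
      omega
    rw [Finset.mem_biUnion]
    refine ⟨k₀, Finset.mem_range.2 hkK, Finset.mem_filter.2 ⟨(mem_zerosBetween (by positivity)).2
      ⟨hz, h1, h2, hlow, hspec⟩, hρ.2⟩⟩
  have hdisj : Set.PairwiseDisjoint (↑(Finset.range K) : Set ℕ)
      (fun k => (zerosBetween (4 ^ k * T) (4 ^ (k + 1) * T)).filter (fun ρ => σ ≤ ρ.re)) := by
    intro i _ j _ hij
    rw [Function.onFun, Finset.disjoint_left]
    intro ρ hi hj
    have hi' := (Finset.mem_filter.1 hi).1
    have hj' := (Finset.mem_filter.1 hj).1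
    obtain ⟨-, -, -, hi3, hi4⟩ := (mem_zerosBetween (by positivity)).1 hi'
    obtain ⟨-, -, -, hj3, hj4⟩ := (mem_zerosBetween (by positivity)).1 hj'
    rcases lt_or_gt_of_ne hij with h | h
    · have : (4 : ℝ) ^ (i + 1) * T ≤ 4 ^ j * T :=
        mul_le_mul_of_nonneg_right (pow_le_pow_right₀ (by norm_num) (by omega)) hT.le
      linarith
    · have : (4 : ℝ) ^ (j + 1) * T ≤ 4 ^ i * T :=
        mul_le_mul_of_nonneg_right (pow_le_pow_right₀ (by norm_num) (by omega)) hT.le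
      linarith
  calc ∑ ρ ∈ (zerosBetween T U).filter (fun ρ => σ ≤ ρ.re), (riemannZetaZeroOrder ρ : ℝ) / ρ.im ^ 2
      ≤ ∑ ρ ∈ (Finset.range K).biUnion
          (fun k => (zerosBetween (4 ^ k * T) (4 ^ (k + 1) * T)).filter (fun ρ => σ ≤ ρ.re)),
            (riemannZetaZeroOrder ρ : ℝ) / ρ.im ^ 2 := by
        refine Finset.sum_le_sum_of_subset_of_nonneg hcover fun ρ hρ _ => ?_
        obtain ⟨k, -, hk⟩ := Finset.mem_biUnion.1 hρ
        exact div_nonneg (zeroOrder_nonneg_of_mem_zerosBetween (by positivity) (Finset.mem_filter.1 hk).1) (sq_nonneg _)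
    _ = ∑ k ∈ Finset.range K, ∑ ρ ∈ (zerosBetween (4 ^ k * T) (4 ^ (k + 1) * T)).filter (fun ρ => σ ≤ ρ.re),
            (riemannZetaZeroOrder ρ : ℝ) / ρ.im ^ 2 := Finset.sum_biUnion hdisj
    _ ≤ ∑ k ∈ Finset.range K, (zetaZeroCountRe σ (4 ^ (k + 1) * T) : ℝ) / (4 ^ k * T) ^ 2 :=
        Finset.sum_le_sum fun k _ => sum_block_le_sigma σ (by positivity)

/-- The block term under a power row: `N(σ, 4ᵏ⁺¹T) ≤ A·(4ᵏ⁺¹T)^a` gives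
`N(σ, 4ᵏ⁺¹T)/(4ᵏT)² ≤ (A·4^a·T^(a−2))·(4^(a−2))ᵏ` (`0 < T`). -/
theorem block_term_le_rpow {σ A a T : ℝ} (hT : 0 < T) (k : ℕ)
    (hNk : (zetaZeroCountRe σ (4 ^ (k + 1) * T) : ℝ) ≤ A * (4 ^ (k + 1) * T) ^ a) :
    (zetaZeroCountRe σ (4 ^ (k + 1) * T) : ℝ) / (4 ^ k * T) ^ 2 ≤
      A * (4 : ℝ) ^ a * T ^ (a - 2) * ((4 : ℝ) ^ (a - 2)) ^ k := by
  have h4 : (0 : ℝ) < 4 := by norm_num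
  have h4k : (0 : ℝ) < 4 ^ k := by positivity
  -- rewrite everything in terms of `u = 4^k` (a real) and rpow
  have e1 : ((4 : ℝ) ^ (k + 1) * T) ^ a = (4 : ℝ) ^ a * ((4 : ℝ) ^ k) ^ a * T ^ a := by
    rw [pow_succ, Real.mul_rpow (by positivity) hT.le, Real.mul_rpow h4k.le h4.le]; ring
  have e2 : ((4 : ℝ) ^ (a - 2)) ^ k = ((4 : ℝ) ^ k) ^ (a - 2) := by
    rw [← Real.rpow_mul_natCast h4.le, mul_comm, Real.rpow_natCast_mul h4.le]
  have e3 : ((4 : ℝ) ^ k) ^ (a - 2) = ((4 : ℝ) ^ k) ^ a / ((4 : ℝ) ^ k) ^ 2 := by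
    rw [Real.rpow_sub h4k, Real.rpow_two]
  have e4 : T ^ (a - 2) = T ^ a / T ^ 2 := by rw [Real.rpow_sub hT, Real.rpow_two]
  rw [e2, e3, e4]
  have hden : (0 : ℝ) < (4 ^ k * T) ^ 2 := by positivity
  calc (zetaZeroCountRe σ (4 ^ (k + 1) * T) : ℝ) / (4 ^ k * T) ^ 2
      ≤ A * (4 ^ (k + 1) * T) ^ a / (4 ^ k * T) ^ 2 := div_le_div_of_nonneg_right hNk hden.le
    _ = A * (4 : ℝ) ^ a * (T ^ a / T ^ 2) * (((4 : ℝ) ^ k) ^ a / ((4 : ℝ) ^ k) ^ 2) := by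
        rw [e1]; field_simp
    _ = _ := by ring

/-- **One-sided density tail of the class `β ≥ σ` from a power row** `N(σ, t) ≤ A·t^a` (`t ≥ 3·10¹²`, `0 ≤ A`, `a < 2`):
for `T ≥ 3·10¹²` and every `U`, `Σ_{T < γ ≤ U, β ≥ σ} m/γ² ≤ A·4^a·T^(a−2)/(1 − 4^(a−2))` (geometric sum of the blocks). -/
theorem sum_oneSided_dens_le_rpow {σ A a T U : ℝ} (hT : 3 * (10 : ℝ) ^ 12 ≤ T) (hA : 0 ≤ A) (ha : a < 2)
    (hN : ∀ t : ℝ, 3 * (10 : ℝ) ^ 12 ≤ t → (zetaZeroCountRe σ t : ℝ) ≤ A * t ^ a) :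
    ∑ ρ ∈ (zerosBetween T U).filter (fun ρ => σ ≤ ρ.re), (riemannZetaZeroOrder ρ : ℝ) / ρ.im ^ 2 ≤
      A * (4 : ℝ) ^ a * T ^ (a - 2) / (1 - (4 : ℝ) ^ (a - 2)) := by
  have hT0 : 0 < T := lt_of_lt_of_le (by norm_num) hT
  obtain ⟨K, hK⟩ : ∃ K : ℕ, U ≤ 4 ^ K * T := by
    obtain ⟨K, hK⟩ := pow_unbounded_of_one_lt (U / T) (by norm_num : (1 : ℝ) < 4)
    exact ⟨K, by rw [div_lt_iff₀ hT0] at hK; exact hK.le⟩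
  refine (sum_oneSided_blocks_le_sigma σ hT0 K hK).trans ?_
  set r : ℝ := (4 : ℝ) ^ (a - 2) with hr
  have hr0 : 0 ≤ r := Real.rpow_nonneg (by norm_num) _
  have hr1 : r < 1 := Real.rpow_lt_one_of_one_lt_of_neg (by norm_num) (by linarith)
  set C : ℝ := A * (4 : ℝ) ^ a * T ^ (a - 2) with hC
  have hC0 : 0 ≤ C := by positivity
  have hterm : ∀ k ∈ Finset.range K,
      (zetaZeroCountRe σ (4 ^ (k + 1) * T) : ℝ) / (4 ^ k * T) ^ 2 ≤ C * r ^ k := by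
    intro k _
    have h4T : 3 * (10 : ℝ) ^ 12 ≤ 4 ^ (k + 1) * T :=
      le_trans hT (le_mul_of_one_le_left hT0.le (one_le_pow₀ (by norm_num)))
    exact block_term_le_rpow hT0 k (hN _ h4T)
  have hgeom : ∑ k ∈ Finset.range K, r ^ k ≤ (1 - r)⁻¹ := by
    have h := geom_sum_Ico_le_of_lt_one (m := 0) (n := K) (x := r) hr0 hr1
    rw [← Finset.range_eq_Ico] at h
    refine h.trans ?_
    rw [pow_zero, div_eq_mul_inv, one_mul]
  calc ∑ k ∈ Finset.range K, (zetaZeroCountRe σ (4 ^ (k + 1) * T) : ℝ) / (4 ^ k * T) ^ 2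
      ≤ ∑ k ∈ Finset.range K, C * r ^ k := Finset.sum_le_sum hterm
    _ = C * ∑ k ∈ Finset.range K, r ^ k := by rw [Finset.mul_sum]
    _ ≤ C * (1 - r)⁻¹ := mul_le_mul_of_nonneg_left hgeom hC0
    _ = C / (1 - r) := by rw [div_eq_mul_inv]

/-- Every finite partial sum of the two-sided tail series of the class `β ≥ σ` is `≤ 2·A·4^a·T^(a−2)/(1 − 4^(a−2))`
(reflection `ρ ↦ ρ̄`; copy of the tree's `sum_densTerm_le`). -/
theorem sum_densTerm_le_rpow {σ A a T : ℝ} (hT : 3 * (10 : ℝ) ^ 12 ≤ T) (hA : 0 ≤ A) (ha : a < 2)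
    (hN : ∀ t : ℝ, 3 * (10 : ℝ) ^ 12 ≤ t → (zetaZeroCountRe σ t : ℝ) ≤ A * t ^ a)
    (s : Finset RHWave0.riemannZetaNontrivialZeros) :
    ∑ ρ ∈ s, (if T < |(ρ : ℂ).im| ∧ σ ≤ (ρ : ℂ).re then
        (riemannZetaZeroOrder (ρ : ℂ) : ℝ) / (ρ : ℂ).im ^ 2 else 0) ≤
      2 * (A * (4 : ℝ) ^ a * T ^ (a - 2) / (1 - (4 : ℝ) ^ (a - 2))) := by
  classical
  have h0 : (0 : ℝ) ≤ T := le_trans (by norm_num) hT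
  set U : ℝ := T + ∑ ρ ∈ s, |(ρ : ℂ).im| with hU
  have hle : ∀ ρ ∈ s, |(ρ : ℂ).im| ≤ U := fun ρ hρ => by
    rw [hU]
    have := Finset.single_le_sum (fun ρ' (_ : ρ' ∈ s) => abs_nonneg ((ρ' : ℂ).im)) hρ
    linarith
  have h1 : ∑ ρ ∈ s.filter (fun ρ : RHWave0.riemannZetaNontrivialZeros => T < |(ρ : ℂ).im| ∧ σ ≤ (ρ : ℂ).re),
        (riemannZetaZeroOrder (ρ : ℂ) : ℝ) / (ρ : ℂ).im ^ 2 ≤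
      ∑ ρ ∈ (zerosUpTo U \ zerosUpTo T).filter (fun ρ : RHWave0.riemannZetaNontrivialZeros => σ ≤ (ρ : ℂ).re),
        (riemannZetaZeroOrder (ρ : ℂ) : ℝ) / (ρ : ℂ).im ^ 2 := by
    refine Finset.sum_le_sum_of_subset_of_nonneg (fun ρ hρ => ?_) fun ρ _ _ =>
      div_nonneg (zeroOrder_nonneg' ρ) (sq_nonneg _)
    rw [Finset.mem_filter] at hρ ⊢
    rw [Finset.mem_sdiff, mem_zerosUpTo, mem_zerosUpTo, not_le]
    exact ⟨⟨hle ρ hρ.1, hρ.2.1⟩, hρ.2.2⟩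
  have h2 := sum_sdiff_zerosUpTo_eq_two_mul h0 (T₂ := U)
    (g := fun z => if σ ≤ z.re then (riemannZetaZeroOrder z : ℝ) / z.im ^ 2 else 0)
    (fun z => by simp only [riemannZetaZeroOrder_conj_holds z, Complex.conj_re, Complex.conj_im, neg_sq])
  have h3 : ∑ ρ ∈ (zerosBetween T U).filter (fun ρ => σ ≤ ρ.re), (riemannZetaZeroOrder ρ : ℝ) / ρ.im ^ 2 ≤
      A * (4 : ℝ) ^ a * T ^ (a - 2) / (1 - (4 : ℝ) ^ (a - 2)) := sum_oneSided_dens_le_rpow hT hA ha hN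
  calc ∑ ρ ∈ s, (if T < |(ρ : ℂ).im| ∧ σ ≤ (ρ : ℂ).re then
          (riemannZetaZeroOrder (ρ : ℂ) : ℝ) / (ρ : ℂ).im ^ 2 else 0)
      = ∑ ρ ∈ s.filter (fun ρ : RHWave0.riemannZetaNontrivialZeros => T < |(ρ : ℂ).im| ∧ σ ≤ (ρ : ℂ).re),
          (riemannZetaZeroOrder (ρ : ℂ) : ℝ) / (ρ : ℂ).im ^ 2 := (Finset.sum_filter _ _).symm
    _ ≤ ∑ ρ ∈ (zerosUpTo U \ zerosUpTo T).filter (fun ρ : RHWave0.riemannZetaNontrivialZeros => σ ≤ (ρ : ℂ).re),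
          (riemannZetaZeroOrder (ρ : ℂ) : ℝ) / (ρ : ℂ).im ^ 2 := h1
    _ = ∑ ρ ∈ zerosUpTo U \ zerosUpTo T,
          (if σ ≤ (ρ : ℂ).re then (riemannZetaZeroOrder (ρ : ℂ) : ℝ) / (ρ : ℂ).im ^ 2 else 0) :=
        Finset.sum_filter _ _
    _ = 2 * ∑ ρ ∈ zerosBetween T U, (if σ ≤ ρ.re then (riemannZetaZeroOrder ρ : ℝ) / ρ.im ^ 2 else 0) := h2
    _ = 2 * ∑ ρ ∈ (zerosBetween T U).filter (fun ρ => σ ≤ ρ.re), (riemannZetaZeroOrder ρ : ℝ) / ρ.im ^ 2 := by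
        rw [Finset.sum_filter]
    _ ≤ 2 * (A * (4 : ℝ) ^ a * T ^ (a - 2) / (1 - (4 : ℝ) ^ (a - 2))) := by
        have h4a : 0 ≤ A * (4 : ℝ) ^ a * T ^ (a - 2) / (1 - (4 : ℝ) ^ (a - 2)) := by
          have hr1 : (4 : ℝ) ^ (a - 2) < 1 := Real.rpow_lt_one_of_one_lt_of_neg (by norm_num) (by linarith)
          have hT0 : 0 < T := lt_of_lt_of_le (by norm_num) hT
          exact div_nonneg (by positivity) (by linarith)
        linarith [h3]

/-- **The density tail of the class `β ≥ σ`** (`T ≥ 3·10¹²`): `Σ_{|γ|>T, β ≥ σ} m(ρ)/γ² ≤ 2·A·4^a·T^(a−2)/(1 − 4^(a−2))`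
from the power row `N(σ, t) ≤ A·t^a` (`t ≥ 3·10¹²`, `0 ≤ A`, `a < 2`).  RH-free (`Real.tsum_le_of_sum_le`). -/
theorem densTail_le_rpow {σ A a T : ℝ} (hT : 3 * (10 : ℝ) ^ 12 ≤ T) (hA : 0 ≤ A) (ha : a < 2)
    (hN : ∀ t : ℝ, 3 * (10 : ℝ) ^ 12 ≤ t → (zetaZeroCountRe σ t : ℝ) ≤ A * t ^ a) :
    ∑' ρ : RHWave0.riemannZetaNontrivialZeros,
        (if T < |(ρ : ℂ).im| ∧ σ ≤ (ρ : ℂ).re then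
          (riemannZetaZeroOrder (ρ : ℂ) : ℝ) / (ρ : ℂ).im ^ 2 else 0) ≤
      2 * (A * (4 : ℝ) ^ a * T ^ (a - 2) / (1 - (4 : ℝ) ^ (a - 2))) := by
  have hnn : 0 ≤ fun ρ : RHWave0.riemannZetaNontrivialZeros =>
      (if T < |(ρ : ℂ).im| ∧ σ ≤ (ρ : ℂ).re then
        (riemannZetaZeroOrder (ρ : ℂ) : ℝ) / (ρ : ℂ).im ^ 2 else 0) := by
    intro ρ
    simp only [Pi.zero_apply]
    split_ifs
    · exact div_nonneg (zeroOrder_nonneg' ρ) (sq_nonneg _)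
    · exact le_rfl
  exact Real.tsum_le_of_sum_le hnn fun s => sum_densTerm_le_rpow hT hA ha hN s

end CakeA

end Summit.RiemannHypothesis.RiemannHypothesis.Theorems.Splittings.RobinFiniteC1

end
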